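import Summits.BirchSwinnertonDyer.BirchSwinnertonDyer.Theorems.ByReductionTypeAtTwoOrdKatoHalfAtTwoIsoSignFreeDefs
import HarnessLib

/-!
# Crux `OrdKatoHalfAtTwoIso` (stmt-BirchSwinnertonDyer-19573), line `steinberg-fibre-at-two`, P7 sign-free re-cut —
# NEGATIVE lemma on child F1μ⁺ `ZetaColemanMuInputsAtTwo` (stmt-BirchSwinnertonDyer-23959): the package is FALSE at every
# habitat curve whose genuine `2`-adic Euler-system classes are all divisible by `2` in `𝐇¹_Γ(T₂W)`

Seat `cruxtriage-stmt-BirchSwinnertonDyer-19573-2` (refuter, crux-triage panel seat 2, gen 30; cell `bsd-2adic`),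
`--supports` the crux; closes nothing. HONEST FRAMING: BSD is not proved by any of this; the crux `OrdKatoHalfAtTwoIso` and its
children are neither proved nor refuted here; no named fact, no definition, no `sorry`; kernel bookkeeping over the line's own
displayed definitions (`HasZetaColemanMuInputsAtTwo`, p678187; `ZetaColemanMuInputsAtTwo`, p684479) and PROVED tree theorems
(`μ_an(E, 2) = 0` on good-ordinary-at-`2` ∧ `ρ̄₂` onto: `AnalyticMuTwo.exists_norm_coeff_padicLFunction_two_eq_one_of_surj`;
INT2-AUTO `exists_iwasawaToPowerSeries_eq_padicLFunction_two_auto`; `(2) ⊂ Λ` prime).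

WHAT. (1) `exists_esClass_not_mem_of_hasZetaColemanMuInputsAtTwo` — the SIGN-FREE first half of the lead's door
`mu_eq_zero_of_hasZetaColemanMuInputsAtTwo` (whose `Δ_W < 0` binder is consumed only later, at socket 1): at a curve `W` good
ordinary at `2` with `ρ̄_{W,2}` onto, the Coleman-coordinate `μ`-inputs for ONE pair `(D, Y)` already force a GENUINE `2`-adic
Euler-system class `s` (`IsEulerSystemClassTwo`) with `s ∉ 2·𝐇¹` in the pinned Iwasawa cohomology they name — because the image
clause gives `s₀ ∉ (2)` with `s₀·G₁ ∈ ℓ(Z)`, `G₁ ∉ (2)` (`μ_an = 0`), `(2)` is prime, so `ℓ(Z) ⊄ (2)`, so `Z ⊄ 2·𝐇¹`, so (span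
clause) some genuine class is `∉ 2·𝐇¹`.  (2) Contrapositive `hasZetaColemanMuInputsAtTwo_false_of_forall_esClass_mem`: if EVERY genuine
class of EVERY pinned `𝐇¹_Γ(T₂W)` lies in `2·𝐇¹`, the inputs fail for every `(f, D, Y)`.  (3) On the displayed child:
`zetaColemanMuInputsAtTwo_exists_esClass_not_mem` — F1μ⁺ commits the line to a `2`-INDIVISIBLE genuine class at EVERY habitat curve of
EITHER sign of `Δ_W` (given any Selmer dual data, which the tree constructs); and `zetaColemanMuInputsAtTwo_false_of_twoDivisible` —
ONE habitat curve (with data) all of whose genuine classes are `2`-divisible refutes F1μ⁺.  This is exactly the hypothesis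
`∃ s, IsEulerSystemClassTwo W hκ I s ∧ s ∉ 2·𝐇¹` of the sign-free core `CoreTheoremAPosDiscTwo` (stmt-…-23967): where it is
unsatisfiable, core⁺ holds vacuously and F1μ⁺ fails.

WHY IT MAY BITE ON `0 < Δ_W` (print level, NOT asserted here — triage `Cruxes/OrdKatoHalfAtTwoIso/TRIAGE-r1-2.md` GEN 30 §B): a genuine
class has `proj_n s = Cor_{ℚ(μ_{2^{n+2}})/ℚ_n}(z)`, a corestriction from a TOTALLY COMPLEX quadratic extension, hence (Mackey:
`res_{⟨c_w⟩} ∘ cor = cor_{1}^{⟨c_w⟩} ∘ res_1 = 0`) it is locally trivial at every real place `w` of every layer `ℚ_n`; on `0 < Δ_W`,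
`H¹(ℝ, T₂E) = ℤ/2` per real place, so `loc_∞ : 𝐇¹_Γ(T₂W) → lim_n 𝔽₂[Gal(ℚ_n/ℚ)] ≅ Λ/2Λ` is `Λ`-linear, and IF `𝐇¹_Γ(T₂W) ≅ Λ` (Kato
12.4 (3) is printed for `p ≠ 2` only) then either `loc_∞ ≡ 0` or `ker loc_∞ = 2·𝐇¹` (`Λ/2 = 𝔽₂⟦T⟧` is a domain) — in the second case
hypothesis `hdiv` below holds at `W`.  On `Δ_W < 0`, `H¹(ℝ, T₂E) = 0` and nothing is constrained (consistent with the PROVED door).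

References: K. Kato, Astérisque 295 (2004), Thm. 12.4 (p. 221), Thm. 12.6 (p. 222), §17.13 (pp. 279–280) [Kato2004Asterisque];
R. Greenberg, LNM 1716 (1999), Lemma 4.6 (pp. 105–107) [GreenbergLNM1716].
-/

set_option linter.dupNamespace false
set_option autoImplicit false

noncomputable section

open scoped Classical MatrixGroups ModularForm NumberField
open CongruenceSubgroup WeierstrassCurve Field IsDedekindDomain
open Literature.NumberTheory.GaloisRepresentations
open Literature.NumberTheory.EllipticCurves Literature.NumberTheory.EllipticCurves.ModularForms
open Literature.NumberTheory.EllipticCurves.Kato2004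
  Literature.NumberTheory.EllipticCurves.Kato2004.EulerSystemValues
open Literature.NumberTheory.EllipticCurves.Rank1Residual
open Summit.BirchSwinnertonDyer.Rank1Residual Summit.BirchSwinnertonDyer.Rank1Residual.X5
open Summit.BirchSwinnertonDyer.BirchSwinnertonDyer.Theorems.SteinbergFibreAtTwo

namespace Summit.BirchSwinnertonDyer.BirchSwinnertonDyer.Theorems.OrdKatoHalfAtTwoIso.Negative.ZetaColemanMuTwoDivisible

section PerDatum

variable {W : WeierstrassCurve ℚ} [W.IsElliptic] [W.IsGloballyMinimal]
  [ContinuousSMul ℤ_[2] (W.tateModule 2)] [Module.Free ℤ_[2] (W.tateModule 2)]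
  [Module.Finite ℤ_[2] (W.tateModule 2)] {N : ℕ} {f : CuspForm (Gamma0 N) 2}
  {κ : ZpExtension ℚ 2} {γ : absoluteGaloisGroup ℚ} {hκ : κ.IsCyclotomic}
  {D : W.SelmerDualData κ γ} {Y : W.FineSelmerDualData κ γ}

/-- **Sign-free extraction.** At `W` good ordinary at `2` with `ρ̄_{W,2}` onto, Kato's zeta classes in Coleman coordinates
at `2` for one pair `(D, Y)` force a GENUINE `2`-adic Euler-system class not divisible by `2` in the pinned `𝐇¹_Γ(T₂W)`
(image clause at `(2)` + `μ_an(E, 2) = 0` + `(2)` prime + span clause; the first half of the lead's door, no sign of `Δ_W` used).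
[cite: Kato2004Asterisque, Thm. 12.6 (p. 222) and §17.13 (p. 280)] -/
theorem exists_esClass_not_mem_of_hasZetaColemanMuInputsAtTwo [NeZero N] (hord : IsOrdinaryAt W 2)
    (h2 : W.HasSurjectiveModNGaloisRep 2) (hf : IsNewformOf W f)
    (h : HasZetaColemanMuInputsAtTwo W f κ γ hκ D Y) :
    ∃ (I : IwasawaH1Data W 2 κ γ) (s : I.H), IsEulerSystemClassTwo W hκ I s ∧
      s ∉ IwasawaAlgebra.augIdealP 2 • (⊤ : Submodule (IwasawaAlgebra 2) I.H) := by
  have hgo : GoodOrd W 2 := ⟨hord.1, hord.2⟩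
  obtain ⟨I, Z, P, ℓ, τ, π, hZ, -, -, -, himg⟩ := h
  -- `L₂(f, α) ∈ ι(Λ)` (INT2-AUTO, PROVED) and `μ_an = 0` (PROVED): `G₁ ∉ (2)`
  obtain ⟨G₁, hG₁⟩ := exists_iwasawaToPowerSeries_eq_padicLFunction_two_auto (W := W) (f := f) hord hf
  have hμL : G₁ ∉ IwasawaAlgebra.augIdealP 2 :=
    not_mem_augIdealP_of_norm_coeff_eq_one hG₁
      (AnalyticMuTwo.exists_norm_coeff_padicLFunction_two_eq_one_of_surj W hgo h2 hf)
  -- the image clause at `(2)`: `s₀ ∉ (2)`, `s₀·G₁ ∈ ℓ(Z)`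
  obtain ⟨s₀, hs₀, hsG⟩ := himg G₁ hG₁
  -- hence some zeta class `z ∈ Z` is not divisible by `2` in `𝐇¹`
  have hz : ∃ z ∈ Z, z ∉ IwasawaAlgebra.augIdealP 2 • (⊤ : Submodule (IwasawaAlgebra 2) I.H) := by
    by_contra hcon
    push Not at hcon
    have hZle : Z ≤ IwasawaAlgebra.augIdealP 2 • (⊤ : Submodule (IwasawaAlgebra 2) I.H) :=
      fun z hz => hcon z hz
    have hsub : Submodule.map (P.subtype ∘ₗ ℓ) Z ≤
        (IwasawaAlgebra.augIdealP 2 • ⊤ : Submodule (IwasawaAlgebra 2) (IwasawaAlgebra 2)) :=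
      (Submodule.map_mono hZle).trans
        (by rw [Submodule.map_smul'']; exact Submodule.smul_mono le_rfl le_top)
    have htop : (IwasawaAlgebra.augIdealP 2 • ⊤ : Submodule (IwasawaAlgebra 2) (IwasawaAlgebra 2)) =
        IwasawaAlgebra.augIdealP 2 := by
      rw [Ideal.smul_eq_mul, Ideal.mul_top]
    have hsG' : s₀ * G₁ ∈ IwasawaAlgebra.augIdealP 2 := by rw [← htop]; exact hsub hsG
    rcases (IwasawaAlgebra.isPrime_augIdealP_holds 2).mem_or_mem hsG' with h' | h'
    · exact hs₀ h'
    · exact hμL h'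
  obtain ⟨z, hzZ, hz2⟩ := hz
  -- and by the span clause some GENUINE `2`-adic Euler-system class is not divisible by `2`
  obtain ⟨s, hs, hsp⟩ := exists_mem_not_mem_of_le_span hZ hzZ hz2
  exact ⟨I, s, hs, hsp⟩

/-- **Negative lemma (contrapositive).** If every genuine `2`-adic Euler-system class of every pinned `𝐇¹_Γ(T₂W)` is
divisible by `2`, Kato's zeta classes in Coleman coordinates at `2` FAIL at `W` for every `(f, D, Y)`.
[cite: Kato2004Asterisque, Thm. 12.6 (p. 222) and §17.13 (p. 280)] -/
theorem hasZetaColemanMuInputsAtTwo_false_of_forall_esClass_mem [NeZero N] (hord : IsOrdinaryAt W 2)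
    (h2 : W.HasSurjectiveModNGaloisRep 2) (hf : IsNewformOf W f)
    (hdiv : ∀ (I : IwasawaH1Data W 2 κ γ) (s : I.H), IsEulerSystemClassTwo W hκ I s →
      s ∈ IwasawaAlgebra.augIdealP 2 • (⊤ : Submodule (IwasawaAlgebra 2) I.H)) :
    ¬ HasZetaColemanMuInputsAtTwo W f κ γ hκ D Y := by
  intro h
  obtain ⟨I, s, hs, hsp⟩ := exists_esClass_not_mem_of_hasZetaColemanMuInputsAtTwo hord h2 hf h
  exact hsp (hdiv I s hs)

end PerDatum

/-- **What F1μ⁺ commits to, by name.** The displayed child `ZetaColemanMuInputsAtTwo` (sign-free) yields, at EVERY habitat curve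
of EITHER sign of `Δ_W` carrying Selmer dual data, a genuine `2`-adic Euler-system class not divisible by `2` in a pinned
`𝐇¹_Γ(T₂W)` — the hypothesis of the sign-free core `CoreTheoremAPosDiscTwo`.
[cite: Kato2004Asterisque, Thm. 12.6 (p. 222) and §17.13 (p. 280)] -/
theorem zetaColemanMuInputsAtTwo_exists_esClass_not_mem (hF : ZetaColemanMuInputsAtTwo)
    (W : WeierstrassCurve ℚ) [W.IsElliptic] [W.IsGloballyMinimal]
    [ContinuousSMul ℤ_[2] (W.tateModule 2)] [Module.Free ℤ_[2] (W.tateModule 2)]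
    [Module.Finite ℤ_[2] (W.tateModule 2)] {N : ℕ} [NeZero N] (f : CuspForm (Gamma0 N) 2)
    (κ : ZpExtension ℚ 2) (γ : absoluteGaloisGroup ℚ) (hκ : κ.IsCyclotomic)
    (hord : IsOrdinaryAt W 2) (h2 : W.HasSurjectiveModNGaloisRep 2) (hγ : κ.IsTopGenerator γ)
    (hcv : IsCyclotomicVariable 2 γ) (hf : IsNewformOf W f)
    (D : W.SelmerDualData κ γ) (Y : W.FineSelmerDualData κ γ) :
    ∃ (I : IwasawaH1Data W 2 κ γ) (s : I.H), IsEulerSystemClassTwo W hκ I s ∧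
      s ∉ IwasawaAlgebra.augIdealP 2 • (⊤ : Submodule (IwasawaAlgebra 2) I.H) :=
  exists_esClass_not_mem_of_hasZetaColemanMuInputsAtTwo hord h2 hf (hF W f κ γ hκ hord h2 hγ hcv hf D Y)

/-- **One `2`-divisible habitat curve refutes F1μ⁺.** If some curve of the habitat (good ordinary at `2`, `ρ̄₂` onto,
EITHER sign of `Δ_W`), with a newform, a cyclotomic variable and Selmer dual data, has all genuine `2`-adic Euler-system
classes of all its pinned `𝐇¹_Γ(T₂W)` divisible by `2`, then `ZetaColemanMuInputsAtTwo` is false.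
[cite: Kato2004Asterisque, Thm. 12.6 (p. 222) and §17.13 (p. 280)] -/
theorem zetaColemanMuInputsAtTwo_false_of_twoDivisible
    (W : WeierstrassCurve ℚ) [W.IsElliptic] [W.IsGloballyMinimal]
    [ContinuousSMul ℤ_[2] (W.tateModule 2)] [Module.Free ℤ_[2] (W.tateModule 2)]
    [Module.Finite ℤ_[2] (W.tateModule 2)] {N : ℕ} [NeZero N] (f : CuspForm (Gamma0 N) 2)
    (κ : ZpExtension ℚ 2) (γ : absoluteGaloisGroup ℚ) (hκ : κ.IsCyclotomic)
    (hord : IsOrdinaryAt W 2) (h2 : W.HasSurjectiveModNGaloisRep 2) (hγ : κ.IsTopGenerator γ)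
    (hcv : IsCyclotomicVariable 2 γ) (hf : IsNewformOf W f)
    (D : W.SelmerDualData κ γ) (Y : W.FineSelmerDualData κ γ)
    (hdiv : ∀ (I : IwasawaH1Data W 2 κ γ) (s : I.H), IsEulerSystemClassTwo W hκ I s →
      s ∈ IwasawaAlgebra.augIdealP 2 • (⊤ : Submodule (IwasawaAlgebra 2) I.H)) :
    ¬ ZetaColemanMuInputsAtTwo := fun hF =>
  hasZetaColemanMuInputsAtTwo_false_of_forall_esClass_mem hord h2 hf hdiv (hF W f κ γ hκ hord h2 hγ hcv hf D Y)

end Summit.BirchSwinnertonDyer.BirchSwinnertonDyer.Theorems.OrdKatoHalfAtTwoIso.Negative.ZetaColemanMuTwoDivisible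

end
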